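import Summits.BirchSwinnertonDyer.BirchSwinnertonDyer.Theorems.EisensteinPrimesResidualDevissageNonsplitLocalData
import Summits.BirchSwinnertonDyer.BirchSwinnertonDyer.Theorems.EisensteinPrimesResidualDevissageSurjectivity
import Literature.NumberTheory.EllipticCurves.CastellaGrossiLeeSkinner2022.ResidualCharacterCohomologySurjective
import HarnessLib

/-!
# The residual λ-IDENTITY `p^{λ(X_ac^{Sf}(E_K))} · #X[p] = #R(S) · #R(E_K[p]/S)` along a stable line whose two characters
# avoid `{𝟙, ω}` at `v̄`, from CGLS22 Prop. 1.2.5 + Cor. 1.2.6 ALONE — and its discharge at a NON-SPLIT multiplicative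
# Eisenstein prime (cell `bsd-eis`, seat `bsd-line-x2-p2` gen 6, D-0154 KEY row 5; crux 4 `BSDpOnCellC` line b1; part 2 of 2 —
# sequel of `…ResidualDevissageNonsplitLocalData` and of g5's `…ResidualDevissage{CountNonsplitIdentity, Surjectivity, NonsplitLocal}`)

HONEST FRAMING (cell `bsd-eis`, run/shared/lean/pub/bsd-eis/): Galois-cohomology bookkeeping on constructed objects; no
definition, no new named fact, no `sorry`, no `Theses` import; nothing about BSD or a main conjecture is asserted; nothing booked;
no label or count moves. Helper `--supports stmt-BirchSwinnertonDyer-19034`; closes no stub. CONDITIONAL on three PUBLISHED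
character-level named facts of Castella–Grossi–Lee–Skinner, Invent. Math. 227 (2022) §1.2 (Rubin 1991 + Hida 2010 (+ Pollack–Weston
A.2) as composed there): `prop14_residualCharacterSelmer_finite` (Prop. 1.2.5: residual character Selmer groups finite) and the two
clauses of Cor. 1.2.6 `cor126_residualCharacter_globalLift` (`H²(K_Σ/K_∞, 𝔽_p(θ)) = 0`, lifting form) / `…_localSurjective`
(global-to-local surjectivity at `v̄`), p639393.

The ONE input left by g5 in the «`≥`» half of the residual λ-count — the residual surjectivity `R(E_K[p]) ↠ R(E_K[p]/S)`, reduced in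
`…ResidualDevissageSurjectivity` (p636532) to (Glob) + (Loc) — IS the pair of clauses of CGLS Cor. 1.2.6 for the SUB-character
`θ = φ` (`𝔽(φ) = S`), available as soon as `D_{v̄}` acts on `S` neither trivially nor through `ω` («`φ|_{G_v̄} ≠ 𝟙, ω`»). The
theorems of §3–§4 are therefore stated for ANY `Γ_K`-stable line `S ≤ E_K[p]` with these local data — REDUCTION-TYPE-FREE, exactly
CGLS's hypothesis «`φ|_{G_p} ≠ 𝟙, ω`» of Props. 1.4.1–1.4.2 (good non-anomalous OR non-split multiplicative `p`) — and then discharged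
at a non-split multiplicative Eisenstein prime by part 1 (`exists_stableSubgroup_localData_of_not_split`: there `D_{v̄}` acts on `S`
and `E_K[p]/S` through `{ωχ, χ}`, `χ` the unramified quadratic character of the non-split Tate curve).

* §3 **`residualSurjective_of_cor126`** — for any stable `S` with `#S = p`, `D_{v̄}` neither trivial nor cyclotomic on `S`, at an
  anticyclotomic Heegner datum (`K` imaginary quadratic, Heegner for `N_E`, `(p)` split, `v̄ ∋ p`, `Σ = Sf` = places over `N_E` off
  `p`): Cor. 1.2.6 (i) + (ii) ⟹ **`∀ z ∈ R(E_K[p]/S), ∃ y ∈ R(E_K[p]), proj_* y = z`** (p636532's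
  `surjOn_datumStrictSelmer_of_global_of_local`, the `p^c` PAIRWISE DISTINCT representatives of part 1 §1 feeding (Loc));
  `exists_stableSubgroup_residualSurjective_of_cor126_of_not_split` — the non-split multiplicative discharge.
* §4 **`pow_lambdaInvariant_mul_eq_of_prop14_of_cor126`** — for any stable `S` with `#S = #(E_K[p]/S) = p` and `D_{v̄}` neither
  trivial nor cyclotomic on `S` and on `E_K[p]/S`: Prop. 1.2.5 + Cor. 1.2.6 ⟹ `R(S)`, `R(E_K[p]/S)` finite and
  **`p^{λ(X^{Sf})} · #X^{Sf}[p] = #R(S) · #R(E_K[p]/S)`** — CGLS Props. 1.4.1–1.4.2 / Keller–Yin Thm. 1.4.1's residual identity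
  (finite part `#X[p]` explicit) in the kernel modulo PUBLISHED character-level facts only: no preprint input, no surjectivity
  hypothesis, no (L), no (S), no reduction-type hypothesis; `pow_lambdaInvariant_mul_eq_of_prop14_of_cor126_of_not_split` — the
  non-split multiplicative Eisenstein datum of Keller–Yin Lemma 5.1.1.

What is NOT here: `#X[p] = 1` («no finite `Λ`-submodule», CGLS Cor. 1.4.3 ⟸ Pollack–Weston A.2 for `M_E`); the character-side
conversion `#R(𝔽(θ)) = p^{λ(𝔛^S_θ)}` (the `λ`-clause of Prop. 1.2.5, not transcribed — `TODO(general form)` of the sister fact);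
the SPLIT multiplicative / good ANOMALOUS cases (one character IS `𝟙` or `ω` at `v̄`: Keller–Yin Cases I–III).

References: [CastellaGrossiLeeSkinner2022] §1.2 Prop. 1.2.5, Cor. 1.2.6, §1.4 Props. 1.4.1–1.4.2 (e-print TeX L681–L880; arXiv:2008.02571:
Prop. 14, Cor. 15, Props. 17–18); [KellerYin2024] Thm. 1.4.1, Rem. 1.4.2, Lemma 5.1.1 (arXiv:2402.12781v2); [GreenbergVatsal2000] §2
Prop. (2.1), (2.8); [PollackWeston2011] Prop. A.2; [Brink2007] Cor. 1; [SilvermanATAEC1994] V.5.3–5.4; cell p636532, p636269, p637140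
(g5), p626493 (g4).
-/

set_option autoImplicit false
set_option linter.dupNamespace false -- the summit namespace `…BirchSwinnertonDyer.BirchSwinnertonDyer.Theorems` (Sub = Summit, D-0017) trips it

noncomputable section

open scoped Classical Pointwise

namespace Summit.BirchSwinnertonDyer.BirchSwinnertonDyer.Theorems.ResidualDevissageNonsplitSurjective

open WeierstrassCurve NumberField IsDedekindDomain Field
  Literature.NumberTheory.EllipticCurves Literature.NumberTheory.EllipticCurves.IwasawaAlgebra
  Literature.NumberTheory.EllipticCurves.GreenbergSelmer
  Literature.NumberTheory.EllipticCurves.GreenbergVatsal2000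
  Literature.NumberTheory.GaloisRepresentations IsDedekindDomain.HeightOneSpectrum
  Literature.NumberTheory.EllipticCurves.Rank1Residual
  Summit.BirchSwinnertonDyer.Rank1Residual.X11b Summit.BirchSwinnertonDyer.Rank1Residual.X11b.AcSelmer
  Summit.BirchSwinnertonDyer.Rank1Residual.X2.ResidualDevissageModules
  Summit.BirchSwinnertonDyer.BirchSwinnertonDyer.Theorems
  Summit.BirchSwinnertonDyer.BirchSwinnertonDyer.Theorems.ResidualDevissageCountNonsplit
  Summit.BirchSwinnertonDyer.BirchSwinnertonDyer.Theorems.ResidualDevissageCountNonsplitIdentity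
  Summit.BirchSwinnertonDyer.BirchSwinnertonDyer.Theorems.ResidualDevissageNonsplitLocal
  Summit.BirchSwinnertonDyer.BirchSwinnertonDyer.Theorems.ResidualDevissageSurjectivity
  Summit.BirchSwinnertonDyer.BirchSwinnertonDyer.Theorems.ResidualDevissageNonsplitLocalData
  Summit.BirchSwinnertonDyer.BirchSwinnertonDyer.Theorems.CumulativeHeegnerInclusionAtThreeResidualDevissage
  Summit.BirchSwinnertonDyer.BirchSwinnertonDyer.Theorems.CumulativeHeegnerInclusionAtThreeTowerFixed
open Literature.NumberTheory.EllipticCurves.CastellaGrossiLeeSkinner2022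
  (prop14_residualCharacterSelmer_finite cor126_residualCharacter_globalLift cor126_residualCharacter_localSurjective)

/-! ### §3 Residual surjectivity `R(E_K[p]) ↠ R(E_K[p]/S)` from CGLS Cor. 1.2.6 -/

section Surjective

/-- **CGLS22 Cor. 1.2.6 ⟹ the residual surjectivity `R(E_K[p]) ↠ R(E_K[p]/S)` along any stable line whose character avoids
`{𝟙, ω}` at `v̄`.** Binders: `W/ℚ`, `2 < p`; `K` imaginary quadratic, Heegner for `N_E`, `(p)` split; `v̄ ∋ p` the STRICT place;
`κ` anticyclotomic; `Sf` = the places of `K` over `N_E` off `p`; `S ≤ E_K[p]` a `Γ_K`-stable subgroup of order `p` on which `D_{v̄}`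
acts neither trivially nor through the mod-`p` cyclotomic character; `R(·) = datumStrictSelmer (ker κ) · p (bdpData · p v̄) ↑Sf`.
CONDITIONAL on the two PUBLISHED named facts (the clauses of Cor. 1.2.6 for `θ = ` the character of `S`): `hlift` supplies (Glob) for
`E_K[p] → E_K[p]/S`, `hlocal` supplies (Loc) for `S` at the `p^c` pairwise distinct places of `K_∞` above `v̄` (part 1 §1); p636532's
`surjOn_datumStrictSelmer_of_global_of_local` assembles them. No reduction-type hypothesis: this is the row-exactness + snake-lemma
step of the proof of CGLS Prop. 1.4.1 under exactly its hypothesis «`φ|_{G_p} ≠ 𝟙, ω`».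
[cite: CastellaGrossiLeeSkinner2022, §1.2 Cor. 1.2.6, §1.4 Prop. 1.4.1 (proof) (e-print TeX L727–858; arXiv:2008.02571 Cor. 15, Prop. 17)]
[cite: KellerYin2024, Thm. 1.4.1 and Rem. 1.4.2 (arXiv:2402.12781v2 §1.4)] [cite: Brink2007, Cor. 1] -/
theorem residualSurjective_of_cor126
    (hlift : cor126_residualCharacter_globalLift) (hlocal : cor126_residualCharacter_localSurjective)
    {p : ℕ} [hp : Fact p.Prime] (W : WeierstrassCurve ℚ) [W.IsElliptic]
    (K : Type) [Field K] [NumberField K] (vbar : HeightOneSpectrum (𝓞 K))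
    (κ : ZpExtension K p) (Sf : Finset (HeightOneSpectrum (𝓞 K)))
    (hp2 : 2 < p) (hK : IsImaginaryQuadratic K) (hH : SatisfiesHeegnerHypothesis (W.conductorNorm ℤ) K)
    (hsplit : ((Ideal.span {(p : ℤ)}).primesOver (𝓞 K)).ncard = 2)
    (hvbar : ((p : ℕ) : 𝓞 K) ∈ vbar.asIdeal) (hκ : κ.IsAnticyclotomic)
    (hSf : ∀ w : HeightOneSpectrum (𝓞 K), w ∈ Sf ↔
      (((W.conductorNorm ℤ : ℤ) : 𝓞 K) ∈ w.asIdeal ∧ ((p : ℕ) : 𝓞 K) ∉ w.asIdeal))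
    (S : StableSubgroup (absoluteGaloisGroup K) ((W.baseChange K).geomTorsion ((p : ℕ) : ℤ)))
    (hSub : Nat.card S.Sub = p) (hnon1 : ¬ ∀ g ∈ decomp vbar, ∀ x : S.Sub, g • x = x)
    (hωS : ¬ ∀ g ∈ decomp vbar, ∀ m : S.Sub,
      g • m = ((modNCyclotomicCharacter K p g : (ZMod p)ˣ) : ZMod p).val • m) :
    ∀ z ∈ datumStrictSelmer κ.kerSubgroup S.Quot p (AcSelmer.bdpData S.Quot p vbar)
        (↑Sf : Set (HeightOneSpectrum (𝓞 K))),
      ∃ y ∈ datumStrictSelmer κ.kerSubgroup ((W.baseChange K).geomTorsion ((p : ℕ) : ℤ)) p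
          (AcSelmer.bdpData _ p vbar) (↑Sf : Set (HeightOneSpectrum (𝓞 K))),
        resH1Hom (ContinuousMonoidHom.id κ.kerSubgroup) S.proj (fun _ b ↦ S.proj_smul _ b) y = z := by
  have hp2' : p ≠ 2 := by omega
  haveI hEK : (W.baseChange K).IsElliptic := inferInstanceAs (W.map (algebraMap ℚ K)).IsElliptic
  obtain ⟨hS₀mem, hgood⟩ := sf_split_and_good (p := p) W K Sf hH hSf
  set S₀ : Set (HeightOneSpectrum (𝓞 K)) := (↑Sf : Set (HeightOneSpectrum (𝓞 K))) with hS₀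
  have hS₀fin : S₀.Finite := Sf.finite_toSet
  -- the modules: continuity and unramifiedness outside `Sf ∪ {w ∣ p}`
  have hM : ∀ m : (W.baseChange K).geomTorsion ((p : ℕ) : ℤ),
      Continuous fun g : absoluteGaloisGroup K ↦ g • m :=
    continuous_smul_geomTorsion (W.baseChange K) ((p : ℕ) : ℤ)
  have hunrE : ∀ w : HeightOneSpectrum (𝓞 K), w ∉ S₀ → ((p : ℕ) : 𝓞 K) ∉ w.asIdeal →
      ∀ x ∈ inertia w, ∀ m : (W.baseChange K).geomTorsion ((p : ℕ) : ℤ), x • m = m :=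
    fun w hw hpw x hx m ↦ smul_geomTorsion_eq_of_mem_inertia_chosen (W.baseChange K) (hgood w hw hpw) hpw hx m
  have hunrSub : ∀ w : HeightOneSpectrum (𝓞 K), w ∉ S₀ → ((p : ℕ) : 𝓞 K) ∉ w.asIdeal →
      ∀ x ∈ inertia w, ∀ m : S.Sub, x • m = m := fun w hw hpw x hx m ↦
    S.incl_injective (by rw [StableSubgroup.incl_smul]; exact hunrE w hw hpw x hx _)
  -- Brink: `D_{v̄} ⊄ ker κ`; the `p^c` pairwise distinct representatives of part 1 §1
  have h𝔭dec : ¬ (decomp vbar ≤ κ.kerSubgroup) :=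
    ZpExtension.decomp_not_le_kerSubgroup_above_of_isAnticyclotomic_holds K p hK hp2' κ hκ vbar hvbar
  obtain ⟨c, hdist, hreps⟩ := exists_reps_distinct_places κ vbar h𝔭dec
  have hτex : ∀ i : ℕ, ∃ τ : absoluteGaloisGroup K, κ τ = Multiplicative.ofAdd ((i : ℕ) : ℤ_[p]) :=
    fun i ↦ κ.surjective _
  choose τ hτ using hτex
  -- (Loc) for `S` from Cor. 1.2.6 (ii)
  have hloc : ∀ w : Fin (p ^ c) → Literature.NumberTheory.EllipticCurves.subgroupH1 (κ.kerSubgroup ⊓ decomp vbar) S.Sub,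
      ∃ a ∈ unramifiedOutside κ.kerSubgroup S.Sub p S₀,
        ∀ i : Fin (p ^ c), resOfLe S.Sub (inf_le_left : κ.kerSubgroup ⊓ decomp vbar ≤ κ.kerSubgroup)
          (conjH1 κ.kerSubgroup S.Sub (τ i) a) = w i := by
    intro w
    have hσ : ∀ i j : Fin (p ^ c), i ≠ j → ∀ δ ∈ decomp vbar, κ (τ j) ≠ κ (τ i) * κ δ := by
      intro i j hij δ hδ
      rw [hτ, hτ]
      exact hdist i j i.2 j.2 (fun h ↦ hij (Fin.ext h)) δ hδ
    exact hlocal K p hK hp2' hsplit κ hκ vbar hvbar S.Sub hSub (S.continuous_smul_sub hM) S₀ hS₀fin hS₀mem hunrSub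
      hnon1 hωS (p ^ c) (fun i ↦ τ i) hσ w
  -- (Glob) for `E_K[p] → E_K[p]/S` from Cor. 1.2.6 (i)
  have hexact : ∀ b : (W.baseChange K).geomTorsion ((p : ℕ) : ℤ), S.proj b = 0 → ∃ a : S.Sub, S.incl a = b :=
    fun b hb ↦ AddMonoidHom.mem_range.mp (S.mem_range_incl_of_proj_eq_zero b hb)
  have hglob : ∀ z ∈ datumStrictSelmer κ.kerSubgroup S.Quot p (AcSelmer.bdpData S.Quot p vbar) S₀,
      ∃ y ∈ unramifiedOutside κ.kerSubgroup ((W.baseChange K).geomTorsion ((p : ℕ) : ℤ)) p S₀,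
        resH1Hom (ContinuousMonoidHom.id κ.kerSubgroup) S.proj (fun _ b ↦ S.proj_smul _ b) y = z := by
    intro z hz
    exact hlift K p hK hp2' hsplit κ hκ vbar hvbar S.Sub hSub (S.continuous_smul_sub hM) S₀ hS₀fin hS₀mem hunrSub
      hnon1 hωS ((W.baseChange K).geomTorsion ((p : ℕ) : ℤ)) S.Quot S.incl S.proj S.proj_smul S.incl_smul
      S.incl_injective S.proj_surjective S.proj_incl hexact hM hunrE z ((mem_datumStrictSelmer_iff _).mp hz).1
  -- representatives for `E_K[p]` and assembly
  exact surjOn_datumStrictSelmer_of_global_of_local κ vbar S₀ hvbar S.incl S.incl_smul S.incl_injective S.proj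
    S.proj_smul S.proj_incl S.proj_surjective hexact hM c τ (hreps ((W.baseChange K).geomTorsion ((p : ℕ) : ℤ)) τ hτ)
    hglob hloc

/-- **At a NON-SPLIT multiplicative Eisenstein datum, CGLS22 Cor. 1.2.6 ⟹ `R(E_K[p]) ↠ R(E_K[p]/S)` for the base-changed rational
line `S`** (`W/ℚ` globally minimal, `p ‖ N` non-split, `E[p]` reducible; `K` Heegner, `(p)` split; `v̄ ∋ p`; `κ` anticyclotomic;
`Σ = Sf`): §3 with its three local hypotheses discharged by part 1 `exists_stableSubgroup_localData_of_not_split`; the remaining local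
data (`D_{v̄}` neither trivial nor cyclotomic on `E_K[p]/S`, no fixed quotient vector) are exported for §4.
[cite: CastellaGrossiLeeSkinner2022, §1.2 Cor. 1.2.6, §1.4 Prop. 1.4.1 (e-print TeX L727–858)] [cite: SilvermanATAEC1994, Ch. V Thm. 5.3, Cor. 5.4] -/
theorem exists_stableSubgroup_residualSurjective_of_cor126_of_not_split
    (hlift : cor126_residualCharacter_globalLift) (hlocal : cor126_residualCharacter_localSurjective)
    {p : ℕ} [hp : Fact p.Prime] (W : WeierstrassCurve ℚ) [W.IsElliptic] [W.IsGloballyMinimal]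
    (K : Type) [Field K] [NumberField K] (vbar : HeightOneSpectrum (𝓞 K))
    (κ : ZpExtension K p) (Sf : Finset (HeightOneSpectrum (𝓞 K)))
    (hp2 : 2 < p) (hmult : Mult W p) (hns : ¬ W.HasSplitMultiplicativeReductionAtPrime p)
    (hred : Red W p) (hK : IsImaginaryQuadratic K)
    (hH : SatisfiesHeegnerHypothesis (W.conductorNorm ℤ) K)
    (hsplit : ((Ideal.span {(p : ℤ)}).primesOver (𝓞 K)).ncard = 2)
    (hvbar : ((p : ℕ) : 𝓞 K) ∈ vbar.asIdeal) (hκ : κ.IsAnticyclotomic)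
    (hSf : ∀ w : HeightOneSpectrum (𝓞 K), w ∈ Sf ↔
      (((W.conductorNorm ℤ : ℤ) : 𝓞 K) ∈ w.asIdeal ∧ ((p : ℕ) : 𝓞 K) ∉ w.asIdeal)) :
    ∃ S : StableSubgroup (absoluteGaloisGroup K) ((W.baseChange K).geomTorsion ((p : ℕ) : ℤ)),
      Nat.card S.Sub = p ∧ Nat.card S.Quot = p ∧
        (¬ ∀ g ∈ decomp vbar, ∀ x : S.Sub, g • x = x) ∧
        (¬ ∀ g ∈ decomp vbar, ∀ y : S.Quot, g • y = y) ∧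
        (¬ ∀ g ∈ decomp vbar, ∀ m : S.Sub,
          g • m = ((modNCyclotomicCharacter K p g : (ZMod p)ˣ) : ZMod p).val • m) ∧
        (¬ ∀ g ∈ decomp vbar, ∀ m : S.Quot,
          g • m = ((modNCyclotomicCharacter K p g : (ZMod p)ˣ) : ZMod p).val • m) ∧
        (∀ y : S.Quot, (∀ g : ↥(κ.kerSubgroup ⊓ decomp vbar), g • y = y) → y = 0) ∧
        ∀ z ∈ datumStrictSelmer κ.kerSubgroup S.Quot p (AcSelmer.bdpData S.Quot p vbar)
            (↑Sf : Set (HeightOneSpectrum (𝓞 K))),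
          ∃ y ∈ datumStrictSelmer κ.kerSubgroup ((W.baseChange K).geomTorsion ((p : ℕ) : ℤ)) p
              (AcSelmer.bdpData _ p vbar) (↑Sf : Set (HeightOneSpectrum (𝓞 K))),
            resH1Hom (ContinuousMonoidHom.id κ.kerSubgroup) S.proj (fun _ b ↦ S.proj_smul _ b) y = z := by
  obtain ⟨S, hSub, hQuot, hnon1, hnon2, hωS, hωQ, hfix⟩ :=
    exists_stableSubgroup_localData_of_not_split W K vbar κ hp2 hmult hns hred hK hsplit hvbar
  exact ⟨S, hSub, hQuot, hnon1, hnon2, hωS, hωQ, hfix,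
    residualSurjective_of_cor126 hlift hlocal W K vbar κ Sf hp2 hK hH hsplit hvbar hκ hSf S hSub hnon1 hωS⟩

end Surjective

/-! ### §4 The residual λ-identity, conditional on CGLS Prop. 1.2.5 + Cor. 1.2.6 ALONE -/

section Identity

/-- **CGLS22 Prop. 1.2.5 + Cor. 1.2.6 ⟹ `p^{λ(X^{Sf})} · #X^{Sf}[p] = #R(S) · #R(E_K[p]/S)` along any stable line whose TWO
characters avoid `{𝟙, ω}` at `v̄`** (`X^{Sf} = AcSelmer.XAc (E_K) p κ v̄ ↑Sf γ` = Keller–Yin's `𝔛^S_f` in the crux-4 dictionary;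
`Sf` = the places of `K` over `N_E` off `p`; `R(·)` the `Sf`-imprimitive residual Greenberg Selmer groups over `K_∞`, STRICT at `v̄`).
Binders as in §3 plus a topological generator `γ` of `κ`, `#(E_K[p]/S) = p`, and `D_{v̄}` neither trivial nor cyclotomic on
`E_K[p]/S` as well. This is the identity of CGLS Props. 1.4.1–1.4.2 / Keller–Yin Thm. 1.4.1 in residual currency —
`dim R(E[p]) = dim R(φ) + dim R(ψ)` with `#R(E_K[p]) = #Sel[p] = p^λ · #X[p]` — under EXACTLY CGLS's hypothesis «`φ|_{G_p} ≠ 𝟙, ω`»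
(no reduction type is assumed): the «`≤`» half is g5's `pow_lambdaInvariant_le_of_stableSubgroup_fixed` (no error term: no fixed
quotient vector up the tower, from `hnon2`), the «`≥`» half is g5's `mul_natCard_le_pow_lambdaInvariant_mul_of_surjective_of_noFixed`
with the residual surjectivity DISCHARGED by §3; (L) at `v̄` follows from `hnon1`/`hnon2` (p637140 §1); the two finiteness inputs are
Prop. 1.2.5 for the two characters. CONDITIONAL on the three PUBLISHED character-level named facts `hfact` (Prop. 1.2.5, finiteness),
`hlift`, `hlocal` (Cor. 1.2.6) and nothing else. Left E-level in Keller–Yin Thm. 1.4.1's λ-clause here: `#X[p] = 1` (CGLS Cor. 1.4.3)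
and the character-side reading `#R(𝔽(θ)) = p^{λ(𝔛^S_θ)}` (Prop. 1.2.5's λ-clause).
[cite: CastellaGrossiLeeSkinner2022, §1.2 Prop. 1.2.5, Cor. 1.2.6, §1.4 Props. 1.4.1–1.4.2 (e-print TeX L681–880; arXiv:2008.02571 Prop. 14, Cor. 15, Props. 17–18)]
[cite: KellerYin2024, Thm. 1.4.1 (arXiv:2402.12781v2 §1.4)] [cite: GreenbergVatsal2000, §2 Prop. (2.8)] [cite: Brink2007, Cor. 1] -/
theorem pow_lambdaInvariant_mul_eq_of_prop14_of_cor126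
    (hfact : prop14_residualCharacterSelmer_finite)
    (hlift : cor126_residualCharacter_globalLift) (hlocal : cor126_residualCharacter_localSurjective)
    {p : ℕ} [hp : Fact p.Prime] (W : WeierstrassCurve ℚ) [W.IsElliptic]
    (K : Type) [Field K] [NumberField K] (vbar : HeightOneSpectrum (𝓞 K))
    (κ : ZpExtension K p) (γ : absoluteGaloisGroup K) [Fact (κ.IsTopGenerator γ)]
    (Sf : Finset (HeightOneSpectrum (𝓞 K)))
    (hp2 : 2 < p) (hK : IsImaginaryQuadratic K) (hH : SatisfiesHeegnerHypothesis (W.conductorNorm ℤ) K)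
    (hsplit : ((Ideal.span {(p : ℤ)}).primesOver (𝓞 K)).ncard = 2)
    (hvbar : ((p : ℕ) : 𝓞 K) ∈ vbar.asIdeal) (hκ : κ.IsAnticyclotomic)
    (hSf : ∀ w : HeightOneSpectrum (𝓞 K), w ∈ Sf ↔
      (((W.conductorNorm ℤ : ℤ) : 𝓞 K) ∈ w.asIdeal ∧ ((p : ℕ) : 𝓞 K) ∉ w.asIdeal))
    (S : StableSubgroup (absoluteGaloisGroup K) ((W.baseChange K).geomTorsion ((p : ℕ) : ℤ)))
    (hSub : Nat.card S.Sub = p) (hQuot : Nat.card S.Quot = p)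
    (hnon1 : ¬ ∀ g ∈ decomp vbar, ∀ x : S.Sub, g • x = x) (hnon2 : ¬ ∀ g ∈ decomp vbar, ∀ y : S.Quot, g • y = y)
    (hωS : ¬ ∀ g ∈ decomp vbar, ∀ m : S.Sub,
      g • m = ((modNCyclotomicCharacter K p g : (ZMod p)ˣ) : ZMod p).val • m)
    (hωQ : ¬ ∀ g ∈ decomp vbar, ∀ m : S.Quot,
      g • m = ((modNCyclotomicCharacter K p g : (ZMod p)ˣ) : ZMod p).val • m) :
    (datumStrictSelmer κ.kerSubgroup S.Sub p (AcSelmer.bdpData S.Sub p vbar) (↑Sf : Set (HeightOneSpectrum (𝓞 K))) :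
        Set (Literature.NumberTheory.EllipticCurves.subgroupH1 κ.kerSubgroup S.Sub)).Finite ∧
      (datumStrictSelmer κ.kerSubgroup S.Quot p (AcSelmer.bdpData S.Quot p vbar) (↑Sf : Set (HeightOneSpectrum (𝓞 K))) :
        Set (Literature.NumberTheory.EllipticCurves.subgroupH1 κ.kerSubgroup S.Quot)).Finite ∧
      p ^ lambdaInvariant p (XAc (W.baseChange K) p κ vbar (↑Sf : Set (HeightOneSpectrum (𝓞 K))) γ) *
          Nat.card {x : XAc (W.baseChange K) p κ vbar (↑Sf : Set (HeightOneSpectrum (𝓞 K))) γ // p • x = 0} =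
        Nat.card (datumStrictSelmer κ.kerSubgroup S.Sub p (AcSelmer.bdpData S.Sub p vbar)
            (↑Sf : Set (HeightOneSpectrum (𝓞 K)))) *
          Nat.card (datumStrictSelmer κ.kerSubgroup S.Quot p (AcSelmer.bdpData S.Quot p vbar)
            (↑Sf : Set (HeightOneSpectrum (𝓞 K)))) := by
  have hp2' : p ≠ 2 := by omega
  haveI hEK : (W.baseChange K).IsElliptic := inferInstanceAs (W.map (algebraMap ℚ K)).IsElliptic
  have hsurjR := residualSurjective_of_cor126 hlift hlocal W K vbar κ Sf hp2 hK hH hsplit hvbar hκ hSf S hSub hnon1 hωS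
  obtain ⟨hS₀mem, hgood⟩ := sf_split_and_good (p := p) W K Sf hH hSf
  set S₀ : Set (HeightOneSpectrum (𝓞 K)) := (↑Sf : Set (HeightOneSpectrum (𝓞 K))) with hS₀
  have hS₀fin : S₀.Finite := Sf.finite_toSet
  have hM : ∀ m : (W.baseChange K).geomTorsion ((p : ℕ) : ℤ),
      Continuous fun g : absoluteGaloisGroup K ↦ g • m :=
    continuous_smul_geomTorsion (W.baseChange K) ((p : ℕ) : ℤ)
  have hunrE : ∀ w : HeightOneSpectrum (𝓞 K), w ∉ S₀ → ((p : ℕ) : 𝓞 K) ∉ w.asIdeal →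
      ∀ x ∈ inertia w, ∀ m : (W.baseChange K).geomTorsion ((p : ℕ) : ℤ), x • m = m :=
    fun w hw hpw x hx m ↦ smul_geomTorsion_eq_of_mem_inertia_chosen (W.baseChange K) (hgood w hw hpw) hpw hx m
  have hunrSub : ∀ w : HeightOneSpectrum (𝓞 K), w ∉ S₀ → ((p : ℕ) : 𝓞 K) ∉ w.asIdeal →
      ∀ x ∈ inertia w, ∀ m : S.Sub, x • m = m := fun w hw hpw x hx m ↦
    S.incl_injective (by rw [StableSubgroup.incl_smul]; exact hunrE w hw hpw x hx _)
  have hunrQuot : ∀ w : HeightOneSpectrum (𝓞 K), w ∉ S₀ → ((p : ℕ) : 𝓞 K) ∉ w.asIdeal →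
      ∀ x ∈ inertia w, ∀ m : S.Quot, x • m = m := fun w hw hpw x hx m ↦ by
    obtain ⟨n, rfl⟩ := S.proj_surjective m
    rw [StableSubgroup.smul_proj, hunrE w hw hpw x hx]
  -- CGLS Prop. 1.2.5: the two residual character Selmer groups are finite
  have hΦ : (datumStrictSelmer κ.kerSubgroup S.Sub p (AcSelmer.bdpData S.Sub p vbar) S₀ :
      Set (Literature.NumberTheory.EllipticCurves.subgroupH1 κ.kerSubgroup S.Sub)).Finite :=
    hfact K p hK hp2' hsplit κ hκ vbar hvbar S.Sub hSub (S.continuous_smul_sub hM) S₀ hS₀fin hS₀mem hunrSub hnon1 hωS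
  have hΨ : (datumStrictSelmer κ.kerSubgroup S.Quot p (AcSelmer.bdpData S.Quot p vbar) S₀ :
      Set (Literature.NumberTheory.EllipticCurves.subgroupH1 κ.kerSubgroup S.Quot)).Finite :=
    hfact K p hK hp2' hsplit κ hκ vbar hvbar S.Quot hQuot (S.continuous_smul_quot hM) S₀ hS₀fin hS₀mem hunrQuot hnon2 hωQ
  -- no fixed vectors up the tower, (L) at `v̄`, Brink, representatives for `S`
  have hfixS : ∀ x : S.Sub, (∀ g : ↥(κ.kerSubgroup ⊓ decomp vbar), g • x = x) → x = 0 :=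
    eq_zero_of_fixed_of_not_forall_decomp_smul_eq κ vbar hSub hnon1
  have hfix : ∀ y : S.Quot, (∀ g : ↥(κ.kerSubgroup ⊓ decomp vbar), g • y = y) → y = 0 :=
    eq_zero_of_fixed_of_not_forall_decomp_smul_eq κ vbar hQuot hnon2
  have hL : ∀ m : (W.baseChange K).geomPrimaryTorsion p,
      (∀ σ ∈ κ.kerSubgroup ⊓ decomp vbar, σ • m = m) → p • m = 0 → m = 0 :=
    noFixedPTorsion_of_forall_fixed_torsion_eq_zero (W.baseChange K) (κ.kerSubgroup ⊓ decomp vbar)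
      (forall_fixed_torsion_eq_zero_of_stableSubgroup (W.baseChange K) (κ.kerSubgroup ⊓ decomp vbar) S
        (fun x hx ↦ hfixS x fun g ↦ hx g.1 g.2) (fun y hy ↦ hfix y fun g ↦ hy g.1 g.2))
  have h𝔭dec : ¬ (decomp vbar ≤ κ.kerSubgroup) :=
    ZpExtension.decomp_not_le_kerSubgroup_above_of_isAnticyclotomic_holds K p hK hp2' κ hκ vbar hvbar
  obtain ⟨c, hc⟩ := UniversalToricDescentResidualSelmerFinite.forall_resOfLe_conjH1_eq_zero_of_reps (M := S.Sub)
    (κ := κ) vbar h𝔭dec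
  have hτex : ∀ i : ℕ, ∃ τ : absoluteGaloisGroup K, κ τ = Multiplicative.ofAdd ((i : ℕ) : ℤ_[p]) :=
    fun i ↦ κ.surjective _
  choose τ hτ using hτex
  -- «≤»: no error term (no fixed quotient vector)
  have hle := pow_lambdaInvariant_le_of_stableSubgroup_fixed (W.baseChange K) κ γ hp2' hvbar h𝔭dec hS₀fin hgood hL S c τ
    (hc τ hτ) hΦ hΨ
  haveI : Subsingleton {y : S.Quot // ∀ g : ↥(κ.kerSubgroup ⊓ decomp vbar), g • y = y} :=
    ⟨fun x y ↦ Subtype.ext ((hfix x.1 x.2).trans (hfix y.1 y.2).symm)⟩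
  haveI : Nonempty {y : S.Quot // ∀ g : ↥(κ.kerSubgroup ⊓ decomp vbar), g • y = y} := ⟨⟨0, fun g ↦ smul_zero g⟩⟩
  have h1 : Nat.card {y : S.Quot // ∀ g : ↥(κ.kerSubgroup ⊓ decomp vbar), g • y = y} = 1 := Nat.card_unique
  rw [h1, one_pow, mul_one] at hle
  -- «≥»: the residual surjectivity of §3
  have hfin := ResidualDevissageFiniteKernel.finite_selmerAc_pTorsion_of_line_devissage_of_finite (W.baseChange K) κ hvbar
    h𝔭dec hgood S hΦ hΨ
  have h2 := UniversalToricDescentResidualSelmerExact.natCard_residualSelmer_eq_natCard_selmerAc_pTorsion (W.baseChange K)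
    κ hp2' hvbar hgood hL
  haveI : Finite {s : selmerAc (W.baseChange K) p κ vbar S₀ // p • s = 0} := hfin.to_subtype
  haveI : Nonempty {s : selmerAc (W.baseChange K) p κ vbar S₀ // p • s = 0} := ⟨⟨0, smul_zero _⟩⟩
  have hE : (datumStrictSelmer κ.kerSubgroup ((W.baseChange K).geomTorsion (p : ℤ)) p (AcSelmer.bdpData _ p vbar) S₀ :
      Set (Literature.NumberTheory.EllipticCurves.subgroupH1 κ.kerSubgroup ((W.baseChange K).geomTorsion (p : ℤ)))).Finite := by
    refine Set.finite_coe_iff.mp (Nat.finite_of_card_ne_zero ?_)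
    change Nat.card (datumStrictSelmer κ.kerSubgroup ((W.baseChange K).geomTorsion (p : ℤ)) p
      (AcSelmer.bdpData _ p vbar) S₀) ≠ 0
    rw [h2]
    exact (Nat.card_pos (α := {s : selmerAc (W.baseChange K) p κ vbar S₀ // p • s = 0})).ne'
  have hge := mul_natCard_le_pow_lambdaInvariant_mul_of_surjective_of_noFixed (W.baseChange K) κ γ hp2' hvbar hS₀fin hgood hL S
    hfix hE hsurjR
  exact ⟨hΦ, hΨ, le_antisymm hle hge⟩

/-- **At every NON-SPLIT multiplicative Eisenstein datum of Keller–Yin Lemma 5.1.1, CGLS22 Prop. 1.2.5 + Cor. 1.2.6 [PUBLISHED] ⟹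
`p^{λ(X^{Sf})} · #X^{Sf}[p] = #R(S) · #R(E_K[p]/S)`** for the base-changed rational line `S` (`W/ℚ` globally minimal, `2 < p`,
`p ‖ N` non-split, `E[p]` reducible; `K` imaginary quadratic, Heegner for `N_E`, `(p)` split; `v̄ ∋ p`; `κ` anticyclotomic with
generator `γ`; `Sf` = the places of `K` over `N_E` off `p`): §4 with its local data supplied by part 1. Keller–Yin Thm. 1.4.1's
residual identity at `p ‖ N` NON-SPLIT in the kernel modulo PUBLISHED character-level facts only — g5's p637140 §3 without its
surjectivity hypothesis. [cite: CastellaGrossiLeeSkinner2022, §1.2 Prop. 1.2.5, Cor. 1.2.6, §1.4 Props. 1.4.1–1.4.2 (e-print TeX L681–880)]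
[cite: KellerYin2024, Thm. 1.4.1, Lemma 5.1.1 and §5.1 ("whose proof still works in the multiplicative reduction setting") (arXiv:2402.12781v2)]
[cite: SilvermanATAEC1994, Ch. V Thm. 5.3, Cor. 5.4] -/
theorem pow_lambdaInvariant_mul_eq_of_prop14_of_cor126_of_not_split
    (hfact : prop14_residualCharacterSelmer_finite)
    (hlift : cor126_residualCharacter_globalLift) (hlocal : cor126_residualCharacter_localSurjective)
    {p : ℕ} [hp : Fact p.Prime] (W : WeierstrassCurve ℚ) [W.IsElliptic] [W.IsGloballyMinimal]
    (K : Type) [Field K] [NumberField K] (vbar : HeightOneSpectrum (𝓞 K))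
    (κ : ZpExtension K p) (γ : absoluteGaloisGroup K) [Fact (κ.IsTopGenerator γ)]
    (Sf : Finset (HeightOneSpectrum (𝓞 K)))
    (hp2 : 2 < p) (hmult : Mult W p) (hns : ¬ W.HasSplitMultiplicativeReductionAtPrime p)
    (hred : Red W p) (hK : IsImaginaryQuadratic K)
    (hH : SatisfiesHeegnerHypothesis (W.conductorNorm ℤ) K)
    (hsplit : ((Ideal.span {(p : ℤ)}).primesOver (𝓞 K)).ncard = 2)
    (hvbar : ((p : ℕ) : 𝓞 K) ∈ vbar.asIdeal) (hκ : κ.IsAnticyclotomic)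
    (hSf : ∀ w : HeightOneSpectrum (𝓞 K), w ∈ Sf ↔
      (((W.conductorNorm ℤ : ℤ) : 𝓞 K) ∈ w.asIdeal ∧ ((p : ℕ) : 𝓞 K) ∉ w.asIdeal)) :
    ∃ S : StableSubgroup (absoluteGaloisGroup K) ((W.baseChange K).geomTorsion ((p : ℕ) : ℤ)),
      Nat.card S.Sub = p ∧ Nat.card S.Quot = p ∧
        (∀ y : S.Quot, (∀ g : ↥(κ.kerSubgroup ⊓ decomp vbar), g • y = y) → y = 0) ∧
        (datumStrictSelmer κ.kerSubgroup S.Sub p (AcSelmer.bdpData S.Sub p vbar) (↑Sf : Set (HeightOneSpectrum (𝓞 K))) :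
          Set (Literature.NumberTheory.EllipticCurves.subgroupH1 κ.kerSubgroup S.Sub)).Finite ∧
        (datumStrictSelmer κ.kerSubgroup S.Quot p (AcSelmer.bdpData S.Quot p vbar) (↑Sf : Set (HeightOneSpectrum (𝓞 K))) :
          Set (Literature.NumberTheory.EllipticCurves.subgroupH1 κ.kerSubgroup S.Quot)).Finite ∧
        p ^ lambdaInvariant p (XAc (W.baseChange K) p κ vbar (↑Sf : Set (HeightOneSpectrum (𝓞 K))) γ) *
            Nat.card {x : XAc (W.baseChange K) p κ vbar (↑Sf : Set (HeightOneSpectrum (𝓞 K))) γ // p • x = 0} =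
          Nat.card (datumStrictSelmer κ.kerSubgroup S.Sub p (AcSelmer.bdpData S.Sub p vbar)
              (↑Sf : Set (HeightOneSpectrum (𝓞 K)))) *
            Nat.card (datumStrictSelmer κ.kerSubgroup S.Quot p (AcSelmer.bdpData S.Quot p vbar)
              (↑Sf : Set (HeightOneSpectrum (𝓞 K)))) := by
  obtain ⟨S, hSub, hQuot, hnon1, hnon2, hωS, hωQ, hfix⟩ :=
    exists_stableSubgroup_localData_of_not_split W K vbar κ hp2 hmult hns hred hK hsplit hvbar
  obtain ⟨hΦ, hΨ, heq⟩ := pow_lambdaInvariant_mul_eq_of_prop14_of_cor126 hfact hlift hlocal W K vbar κ γ Sf hp2 hK hH hsplit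
    hvbar hκ hSf S hSub hQuot hnon1 hnon2 hωS hωQ
  exact ⟨S, hSub, hQuot, hfix, hΦ, hΨ, heq⟩

end Identity

end Summit.BirchSwinnertonDyer.BirchSwinnertonDyer.Theorems.ResidualDevissageNonsplitSurjective

end
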